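import Summits.NavierStokesRegularity.NavierStokesRegularity.Theorems.TypeICertificateLadderTargetRungOfDepletion
import Literature.Analysis.FluidPDE.WholeSpaceIBP
import Literature.Analysis.FluidPDE.EnergyToolkit
import HarnessLib

/-!
# Crux `Target` = `TypeICertificateLadder.NoTypeIBlowup` (stmt-NavierStokesRegularity-1217), line
# `depletion-ladder`: the Cauchy–Schwarz member `κ = 1` of the depletion family IS a theorem

`--supports stmt-NavierStokesRegularity-1217` (line `depletion-ladder`; companion of the landed stub
S2 `Theorems.rung_of_stretchingDepletion`, p471856).

The line's hypothesis `DepletionLadder.StretchingDepletion κ` — for every `C²` divergence-free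
`u : ℝ³ → ℝ³` bounded by `M`, with `ω = curl u`, `ω ∈ L²`, `∇ω ∈ L²` and integrable stretching
density, `|∫ ⟪ω, Du ω⟫| ≤ κ·M·‖ω‖₂·‖∇ω‖₂` — is stated on a deliberately wide class (no decay of `u`,
no bound on `∇u`). This file certifies that the family is INHABITED at the Cauchy–Schwarz value
`κ = 1` on exactly that class (`stretchingDepletion_one`), so S2 is not a vacuous implication and
its `κ = 1` instance recovers the enstrophy rungs `X_C`, `C < 1` (`rung_of_enstrophy_depletion`,
the line card's "the case `κ = 1` is the enstrophy rung `C < 1`, `budgetCloses_two_iff`").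

Proof of `κ = 1` on the wide class: no termwise integration by parts is available (only the sum
`Σⱼ ωⱼ⟪ω, ∂ⱼu⟫` is known to be integrable), so the stretching integral is cut off with the tree's
smooth `cutoff R` and integrated by parts at finite `R` through the compactly supported trilinear
identity `integral_inner_convect_add_eq_zero` (`∫⟪(ω·∇)u, χω⟫ + ∫⟪u, (ω·∇)(χω)⟫ + ∫(div ω)⟪u, χω⟫ = 0`,
`div curl = 0`):
`∫ χ_R ⟪ω, Du ω⟫ = −∫ (Dχ_R ω)⟪u, ω⟫ − ∫ χ_R ⟪u, Dω ω⟫`, whence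
`|∫ χ_R ⟪ω, Du ω⟫| ≤ (C/R)·M·‖ω‖₂² + M·‖ω‖₂·‖∇ω‖₂` (`|Dω ω| ≤ |∇ω|_F |ω|`, Cauchy–Schwarz); then
`R → ∞` by dominated convergence (the stretching density is integrable by hypothesis).

WHAT THIS IS NOT: no depletion (`κ < 1` is S1's open content); an elementary certificate. [folklore]
-/

noncomputable section

open Set Filter Topology MeasureTheory
open scoped RealInnerProductSpace ENNReal NNReal Laplacian ContDiff
open Literature.Analysis.FluidPDE

namespace Summit.NavierStokesRegularity.NavierStokesRegularity.Theorems.DepletionLadder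

-- the problem directory repeats the summit name (`NavierStokesRegularity/NavierStokesRegularity`)
set_option linter.dupNamespace false

/-- **The cut-off stretching identity and bound.** For `u ∈ C²(ℝ³; ℝ³)` bounded by `M` with
`ω = curl u`, `ω, |∇ω|_F ∈ L²`, and the smooth cut-off `χ_R` (`R > 0`, `‖Dχ_R‖ ≤ C/R`):
`|∫ χ_R ⟪ω, Du ω⟫| ≤ M·(C/R)·∫‖ω‖² + M·√(∫|∇ω|²_F)·√(∫‖ω‖²)`, by the compactly supported trilinear
identity `integral_inner_convect_add_eq_zero` with `div curl u = 0`. [folklore] -/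
theorem abs_integral_cutoff_mul_stretching_le {u : EuclideanSpace ℝ (Fin 3) → EuclideanSpace ℝ (Fin 3)}
    {M : ℝ} (hu : ContDiff ℝ 2 u) (hM : ∀ x, ‖u x‖ ≤ M)
    (iZ : Integrable (fun x => ‖curl u x‖ ^ 2))
    (iA : Integrable (fun x => frobeniusNormSq (fderiv ℝ (curl u) x)))
    {C : ℝ} (hC0 : 0 ≤ C) (hC : ∀ R : ℝ, 0 < R → ∀ x : EuclideanSpace ℝ (Fin 3),
      ‖fderiv ℝ (cutoff R) x‖ ≤ C / R)
    {R : ℝ} (hR : 0 < R) :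
    |∫ x, cutoff R x * ⟪curl u x, fderiv ℝ u x (curl u x)⟫| ≤
      M * (C / R) * (∫ x, ‖curl u x‖ ^ 2) +
        M * (Real.sqrt (∫ x, frobeniusNormSq (fderiv ℝ (curl u) x)) *
          Real.sqrt (∫ x, ‖curl u x‖ ^ 2)) := by
  have hu1 : ContDiff ℝ 1 u := hu.of_le (by norm_num)
  have hω1 : ContDiff ℝ 1 (curl u) := by
    rw [curl_eq_curlCLM_comp]
    exact curlCLM.contDiff.comp (hu.fderiv_right (m := 1) (by norm_num))
  have hM0 : 0 ≤ M := (norm_nonneg _).trans (hM 0)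
  have hdivω : ∀ x, VectorCalculus.divergence (curl u) x = 0 := fun x =>
    divergence_curl_eq_zero_holds u hu x
  have cω : Continuous (curl u) := hω1.continuous
  have cDω : Continuous (fderiv ℝ (curl u)) := hω1.continuous_fderiv one_ne_zero
  -- the cut-off test field `χ ω`
  set χ : EuclideanSpace ℝ (Fin 3) → ℝ := cutoff R with hχdef
  have hχ : ContDiff ℝ 1 χ := contDiff_cutoff R
  have hχc : HasCompactSupport χ := hasCompactSupport_cutoff hR
  have hw : ContDiff ℝ 1 (fun y => χ y • curl u y) := hχ.smul hω1
  have hwc : HasCompactSupport (fun y => χ y • curl u y) := hχc.smul_right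
  -- the trilinear identity with advecting field `ω` (divergence free), `v = u`, `w = χ ω`
  have hid := integral_inner_convect_add_eq_zero (u := curl u) (v := u)
    (w := fun y => χ y • curl u y) hω1 hu1 hw hwc
  have h3 : ∫ x, VectorCalculus.divergence (curl u) x * ⟪u x, χ x • curl u x⟫ = 0 := by
    simp [hdivω]
  have h1 : ∫ x, ⟪convect (curl u) u x, χ x • curl u x⟫ =
      ∫ x, χ x * ⟪curl u x, fderiv ℝ u x (curl u x)⟫ :=
    integral_congr_ae (Eventually.of_forall fun x => by
      simp only [convect]
      rw [real_inner_smul_right, real_inner_comm])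
  -- product rule for the test field along `ω`
  have hprod : ∀ x, convect (curl u) (fun y => χ y • curl u y) x =
      χ x • fderiv ℝ (curl u) x (curl u x) + (fderiv ℝ χ x (curl u x)) • curl u x := by
    intro x
    simp only [convect]
    rw [fderiv_fun_smul (hχ.differentiable one_ne_zero x) (hω1.differentiable one_ne_zero x)]
    simp only [add_apply, FunLike.coe_smul, Pi.smul_apply,
      ContinuousLinearMap.smulRight_apply]
  have h2 : ∫ x, ⟪u x, convect (curl u) (fun y => χ y • curl u y) x⟫ =
      ∫ x, (χ x * ⟪u x, fderiv ℝ (curl u) x (curl u x)⟫ +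
        fderiv ℝ χ x (curl u x) * ⟪u x, curl u x⟫) :=
    integral_congr_ae (Eventually.of_forall fun x => by
      simp only [hprod x, inner_add_right, real_inner_smul_right])
  rw [h1, h2, h3, add_zero] at hid
  -- so `J_R = −∫ (χ⟪u, Dω ω⟫ + (Dχ ω)⟪u, ω⟫)`
  have hJR : ∫ x, χ x * ⟪curl u x, fderiv ℝ u x (curl u x)⟫ =
      -∫ x, (χ x * ⟪u x, fderiv ℝ (curl u) x (curl u x)⟫ +
        fderiv ℝ χ x (curl u x) * ⟪u x, curl u x⟫) := by linarith
  -- pointwise domination of the right-hand integrand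
  set g : EuclideanSpace ℝ (Fin 3) → ℝ := fun x =>
    M * (Real.sqrt (frobeniusNormSq (fderiv ℝ (curl u) x)) * ‖curl u x‖) +
      M * (C / R) * ‖curl u x‖ ^ 2 with hgdef
  have hop : ∀ x, ‖fderiv ℝ (curl u) x (curl u x)‖ ≤
      Real.sqrt (frobeniusNormSq (fderiv ℝ (curl u) x)) * ‖curl u x‖ := by
    intro x
    refine ((fderiv ℝ (curl u) x).le_opNorm _).trans (mul_le_mul_of_nonneg_right ?_ (norm_nonneg _))
    rw [← Real.sqrt_sq (norm_nonneg (fderiv ℝ (curl u) x))]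
    exact Real.sqrt_le_sqrt (sq_opNorm_le_frobeniusNormSq _)
  have hdom : ∀ x, ‖χ x * ⟪u x, fderiv ℝ (curl u) x (curl u x)⟫ +
      fderiv ℝ χ x (curl u x) * ⟪u x, curl u x⟫‖ ≤ g x := by
    intro x
    have hχ01 : |χ x| ≤ 1 := abs_cutoff_le_one R x
    have ha : ‖χ x * ⟪u x, fderiv ℝ (curl u) x (curl u x)⟫‖ ≤
        M * (Real.sqrt (frobeniusNormSq (fderiv ℝ (curl u) x)) * ‖curl u x‖) := by
      rw [norm_mul, Real.norm_eq_abs]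
      calc |χ x| * ‖⟪u x, fderiv ℝ (curl u) x (curl u x)⟫‖
          ≤ 1 * (‖u x‖ * ‖fderiv ℝ (curl u) x (curl u x)‖) :=
            mul_le_mul hχ01 (norm_inner_le_norm _ _) (norm_nonneg _) zero_le_one
        _ ≤ 1 * (M * (Real.sqrt (frobeniusNormSq (fderiv ℝ (curl u) x)) * ‖curl u x‖)) := by
            gcongr
            · exact hM x
            · exact hop x
        _ = _ := one_mul _
    have hb : ‖fderiv ℝ χ x (curl u x) * ⟪u x, curl u x⟫‖ ≤ M * (C / R) * ‖curl u x‖ ^ 2 := by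
      rw [norm_mul]
      have h1 : ‖fderiv ℝ χ x (curl u x)‖ ≤ C / R * ‖curl u x‖ :=
        (fderiv ℝ χ x).le_of_opNorm_le (hC R hR x) _
      have h2 : ‖⟪u x, curl u x⟫‖ ≤ M * ‖curl u x‖ :=
        (norm_inner_le_norm _ _).trans (mul_le_mul_of_nonneg_right (hM x) (norm_nonneg _))
      calc ‖fderiv ℝ χ x (curl u x)‖ * ‖⟪u x, curl u x⟫‖
          ≤ (C / R * ‖curl u x‖) * (M * ‖curl u x‖) :=
            mul_le_mul h1 h2 (norm_nonneg _) (by positivity)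
        _ = M * (C / R) * ‖curl u x‖ ^ 2 := by ring
    exact (norm_add_le _ _).trans (add_le_add ha hb)
  -- integrability of the dominating function: `√|∇ω|²_F · ‖ω‖ ≤ (|∇ω|²_F + ‖ω‖²)/2`
  have ihalf : Integrable (fun x => (frobeniusNormSq (fderiv ℝ (curl u) x) + ‖curl u x‖ ^ 2) / 2) :=
    (iA.add iZ).div_const 2
  have iprod : Integrable (fun x => Real.sqrt (frobeniusNormSq (fderiv ℝ (curl u) x)) * ‖curl u x‖) := by
    refine Integrable.mono' ihalf
      (((continuous_frobeniusNormSq_fderiv hω1 one_ne_zero).sqrt.mul cω.norm).aestronglyMeasurable)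
      (Eventually.of_forall fun x => ?_)
    have ha : 0 ≤ Real.sqrt (frobeniusNormSq (fderiv ℝ (curl u) x)) := Real.sqrt_nonneg _
    have hb : 0 ≤ ‖curl u x‖ := norm_nonneg _
    rw [Real.norm_of_nonneg (mul_nonneg ha hb)]
    have hsq : Real.sqrt (frobeniusNormSq (fderiv ℝ (curl u) x)) ^ 2 =
        frobeniusNormSq (fderiv ℝ (curl u) x) := Real.sq_sqrt (frobeniusNormSq_nonneg _)
    show Real.sqrt (frobeniusNormSq (fderiv ℝ (curl u) x)) * ‖curl u x‖ ≤
      (frobeniusNormSq (fderiv ℝ (curl u) x) + ‖curl u x‖ ^ 2) / 2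
    nlinarith [sq_nonneg (Real.sqrt (frobeniusNormSq (fderiv ℝ (curl u) x)) - ‖curl u x‖)]
  have ig : Integrable g := (iprod.const_mul M).add (iZ.const_mul (M * (C / R)))
  -- Cauchy–Schwarz for the product
  have mω : MemLp (fun x => ‖curl u x‖) 2 volume :=
    (memLp_two_iff_integrable_sq_norm cω.norm.aestronglyMeasurable).2 (by simpa using iZ)
  have mF : MemLp (fun x => Real.sqrt (frobeniusNormSq (fderiv ℝ (curl u) x))) 2 volume := by
    refine (memLp_two_iff_integrable_sq_norm
      (continuous_frobeniusNormSq_fderiv hω1 one_ne_zero).sqrt.aestronglyMeasurable).2 ?_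
    refine iA.congr (Eventually.of_forall fun x => ?_)
    simp only [Real.norm_eq_abs, sq_abs, Real.sq_sqrt (frobeniusNormSq_nonneg _)]
  have hCS : ∫ x, Real.sqrt (frobeniusNormSq (fderiv ℝ (curl u) x)) * ‖curl u x‖ ≤
      Real.sqrt (∫ x, frobeniusNormSq (fderiv ℝ (curl u) x)) * Real.sqrt (∫ x, ‖curl u x‖ ^ 2) := by
    have h := integral_mul_le_sqrt_mul_sqrt_of_memLp mF mω
    have he : ∫ x, Real.sqrt (frobeniusNormSq (fderiv ℝ (curl u) x)) ^ 2 =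
        ∫ x, frobeniusNormSq (fderiv ℝ (curl u) x) :=
      integral_congr_ae (Eventually.of_forall fun x => Real.sq_sqrt (frobeniusNormSq_nonneg _))
    rwa [he] at h
  -- assemble
  rw [hJR, abs_neg]
  calc |∫ x, (χ x * ⟪u x, fderiv ℝ (curl u) x (curl u x)⟫ + fderiv ℝ χ x (curl u x) * ⟪u x, curl u x⟫)|
      ≤ ∫ x, g x := by
        rw [← Real.norm_eq_abs]
        exact norm_integral_le_of_norm_le ig (Eventually.of_forall hdom)
    _ = M * (∫ x, Real.sqrt (frobeniusNormSq (fderiv ℝ (curl u) x)) * ‖curl u x‖) +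
          M * (C / R) * ∫ x, ‖curl u x‖ ^ 2 := by
        rw [hgdef, integral_add (iprod.const_mul M) (iZ.const_mul _), integral_const_mul,
          integral_const_mul]
    _ ≤ M * (Real.sqrt (∫ x, frobeniusNormSq (fderiv ℝ (curl u) x)) *
          Real.sqrt (∫ x, ‖curl u x‖ ^ 2)) + M * (C / R) * ∫ x, ‖curl u x‖ ^ 2 := by
        gcongr
    _ = _ := add_comm _ _

/-- **The depletion family is inhabited at `κ = 1` (Cauchy–Schwarz): `StretchingDepletion 1`,
VERBATIM after unfolding.** For every `C²` divergence-free `u : ℝ³ → ℝ³` bounded by `M` with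
`curl u ∈ L²`, `|∇ curl u|_F ∈ L²` (i.e. `∫ frobeniusNormSq (D curl u) < ∞`) and integrable
stretching density, `|∫ ⟪curl u, Du (curl u)⟫| ≤ 1 · M · ‖curl u‖₂ · ‖∇ curl u‖₂`.
Proof: `abs_integral_cutoff_mul_stretching_le` at `R = n + 1` and dominated convergence
(`cutoff (n+1) → 1` pointwise, `|cutoff| ≤ 1`). The divergence-free hypothesis on `u` is not used
(only `div curl u = 0` enters); it is kept to match the line's definition. [folklore] -/
theorem stretchingDepletion_one :
    ∀ (u : EuclideanSpace ℝ (Fin 3) → EuclideanSpace ℝ (Fin 3)) (M : ℝ), ContDiff ℝ 2 u →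
      VectorCalculus.IsDivFree u → (∀ x, ‖u x‖ ≤ M) →
      Integrable (fun x => ‖curl u x‖ ^ 2) →
      Integrable (fun x => frobeniusNormSq (fderiv ℝ (curl u) x)) →
      Integrable (fun x => ⟪curl u x, fderiv ℝ u x (curl u x)⟫) →
      |∫ x, ⟪curl u x, fderiv ℝ u x (curl u x)⟫| ≤
        1 * M * Real.sqrt (∫ x, ‖curl u x‖ ^ 2) *
          Real.sqrt (∫ x, frobeniusNormSq (fderiv ℝ (curl u) x)) := by
  intro u M hu _hdiv hM iZ iA iJ
  obtain ⟨C, hC0, hC⟩ := exists_norm_fderiv_cutoff_le (E := EuclideanSpace ℝ (Fin 3))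
  have hu1 : ContDiff ℝ 1 u := hu.of_le (by norm_num)
  have hω1 : ContDiff ℝ 1 (curl u) := by
    rw [curl_eq_curlCLM_comp]
    exact curlCLM.contDiff.comp (hu.fderiv_right (m := 1) (by norm_num))
  have cω : Continuous (curl u) := hω1.continuous
  set Z : ℝ := ∫ x, ‖curl u x‖ ^ 2 with hZdef
  set A : ℝ := ∫ x, frobeniusNormSq (fderiv ℝ (curl u) x) with hAdef
  set J : ℝ := ∫ x, ⟪curl u x, fderiv ℝ u x (curl u x)⟫ with hJdef
  -- the cut-off bound at `R = n + 1`
  have hn : ∀ n : ℕ, |∫ x, cutoff ((n : ℝ) + 1) x * ⟪curl u x, fderiv ℝ u x (curl u x)⟫| ≤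
      M * (C / ((n : ℝ) + 1)) * Z + M * (Real.sqrt A * Real.sqrt Z) := fun n =>
    abs_integral_cutoff_mul_stretching_le hu hM iZ iA hC0 hC (by positivity)
  -- dominated convergence: the cut-off integrals tend to `J`
  have cstr : Continuous fun x => ⟪curl u x, fderiv ℝ u x (curl u x)⟫ :=
    cω.inner ((hu1.continuous_fderiv one_ne_zero).clm_apply cω)
  have hlim : Tendsto (fun n : ℕ => ∫ x, cutoff ((n : ℝ) + 1) x * ⟪curl u x, fderiv ℝ u x (curl u x)⟫)
      atTop (𝓝 J) := by
    refine tendsto_integral_of_dominated_convergence (fun x => ‖⟪curl u x, fderiv ℝ u x (curl u x)⟫‖)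
      (fun n => (((contDiff_cutoff (n := 1) ((n : ℝ) + 1)).continuous).mul cstr).aestronglyMeasurable)
      iJ.norm (fun n => Eventually.of_forall fun x => ?_) (Eventually.of_forall fun x => ?_)
    · rw [norm_mul, Real.norm_eq_abs]
      exact mul_le_of_le_one_left (norm_nonneg _) (abs_cutoff_le_one _ x)
    · have h := (tendsto_cutoff_natCast_add_one x).mul_const ⟪curl u x, fderiv ℝ u x (curl u x)⟫
      rwa [one_mul] at h
  have habs : Tendsto (fun n : ℕ => |∫ x, cutoff ((n : ℝ) + 1) x *
      ⟪curl u x, fderiv ℝ u x (curl u x)⟫|) atTop (𝓝 |J|) := hlim.abs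
  have hrhs : Tendsto (fun n : ℕ => M * (C / ((n : ℝ) + 1)) * Z + M * (Real.sqrt A * Real.sqrt Z))
      atTop (𝓝 (M * 0 * Z + M * (Real.sqrt A * Real.sqrt Z))) := by
    have h0 : Tendsto (fun n : ℕ => C / ((n : ℝ) + 1)) atTop (𝓝 0) := by
      have h := (tendsto_one_div_add_atTop_nhds_zero_nat (𝕜 := ℝ)).const_mul C
      rw [mul_zero] at h
      refine h.congr fun n => ?_
      rw [mul_one_div]
    exact ((h0.const_mul M).mul_const Z).add_const _
  have hle := le_of_tendsto_of_tendsto' habs hrhs hn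
  simp only [mul_zero, zero_mul, zero_add] at hle
  calc |J| ≤ M * (Real.sqrt A * Real.sqrt Z) := hle
    _ = 1 * M * Real.sqrt Z * Real.sqrt A := by ring

/-- **The `κ = 1` instance of S2 reproduces the enstrophy rungs** (consistency certificate of the
line, card §Idea: "the enstrophy member of the budget family is EXACTLY the case `κ̂ = 1`
(`budgetCloses_two_iff`: reach `C < 1`)"): every rung `X_C` with `0 < C < 1` holds, by
`Theorems.rung_of_stretchingDepletion` at `κ = 1` and `stretchingDepletion_one`. (These rungs are
below the landed rung one, `typeICertificateLadder_rungReynoldsOne`; the point is that the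
depletion route is sound end to end.) [folklore] -/
theorem rung_of_enstrophy_depletion {C : ℝ} (hC : 0 < C) (hC1 : C < 1) {ν T : ℝ} (hν : 0 < ν)
    (hT : 0 < T) {u : ℝ → EuclideanSpace ℝ (Fin 3) → EuclideanSpace ℝ (Fin 3)}
    {p : ℝ → EuclideanSpace ℝ (Fin 3) → ℝ}
    (hsol : IsClassicalNSSolutionOn (Set.Ico 0 T) ν 0 u p) (hLH : IsLerayHopfOn T ν 0 (u 0) u)
    (hdec : HasRapidSpatialDecay (u 0))
    (hrate : ∀ᶠ t in 𝓝[<] T, ∀ x, Real.sqrt (T - t) * ‖u t x‖ ≤ C * Real.sqrt ν) :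
    HasSmoothExtensionPast ν 0 u T :=
  Summit.NavierStokesRegularity.NavierStokesRegularity.Theorems.rung_of_stretchingDepletion 1 one_pos
    stretchingDepletion_one C hC (by linarith) ν T hν hT u p hsol hLH hdec hrate

end Summit.NavierStokesRegularity.NavierStokesRegularity.Theorems.DepletionLadder

end
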